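import Literature.Analysis.InnerProduct.RealProjectivePlaneHeatTraceExpansion
import Literature.Analysis.InnerProduct.OddPowerGaussianSumAsymptotics
import Literature.Analysis.InnerProduct.TwistedCircleHeatTraceExpansion
import Mathlib.Analysis.Calculus.SmoothSeries
import HarnessLib

/-!
# The alternating odd-power theta series on the half-integers: `∑_{n≥0}(−1)ⁿ(2n+1)^{2k+1}e^{−t(n+½)²} = O(t^β)` as
# `t → 0⁺`, for EVERY `k` and EVERY `β` — the reciprocity `T_k(t) = ∑_{i≤k} c_{k,i}t^{−(k+3/2+i)}Θ_i(4π²/t)` with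
# `Θ_i(y) = ∑_{n∈ℤ}(n+¼)^{2i+1}e^{−y(n+¼)²} = O(e^{−y/16})`

Layer `Literature/Analysis/InnerProduct`, namespace `Literature.Analysis.InnerProduct`; the analytic tool behind the heat
trace of every EVEN-dimensional real projective space `RP^{2m} = S^{2m}/{±1}` (the antipodal map acts by `(−1)^l` on the
harmonics of degree `l`, and the multiplicities of `S^{2m}` are ODD polynomials in `u = 2l+2m−1`, row g41-#2), extending the
one case already in the tree, `k = 0`: row g40-#2 (`RealProjectivePlaneHeatTraceExpansion.lean`, REUSED:
`tsum_twoSphere_twisted`, i.e. `∑(−1)^l(2l+1)e^{−t·l(l+1)} = ½e^{t/4}·sinKernel(¼)(t/4π)`), built on Mathlib's twisted theta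
kernels (`HurwitzZeta.oddKernel_functional_equation`, `HurwitzZeta.hasSum_int_oddKernel`). The method is that of row g38's
`JacobiThetaDerivativesAsymptotics.lean` (the derivatives of Jacobi's `θ`), transplanted from `θ(t) = √(π/t)θ(π²/t)` to the
twisted kernel: differentiate the `k = 0` reciprocity `k` times, termwise on both sides (`hasDerivAt_tsum_of_isPreconnected`),
and bound the dual series, all of whose terms are exponentially small because the dual lattice `ℤ + ¼` does not contain `0`.
Also REUSED: `summable_odd_pow_mul_exp_neg_mul_add_half_sq` (row g41-#1), `summable_exp_neg_mul_intCast_add_sq` (row g38),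
`isBigO_exp_neg_div_nhdsGT` (row g37-#8). Lane `lit-hodgefound` (Track 2 foundations library), prover seat `lit-hodgefound-p06`
(generation 41), self-proposed row g41-#4. THEOREMS ONLY (no definition, no instance, no notation, no named fact).
TODO(general form): the same argument gives `∑ₙ 2n·sin(2πna)·n^{2k}e^{−πn²x} = O(x^∞)` for every `a ∉ ℤ`; only `a = ¼` (the
antipodal twist) is carried out.

## Sources

P. H. Bérard, *Spectral Geometry: Direct and Inverse Problems* (LNM 1207, 1986), Ch. V nº6 (ii) (the Poisson summation
formula ∕ Jacobi's imaginary transformation of theta series — here in Mathlib's form `oddKernel a x = x^{−3/2}·sinKernel a (1/x)`,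
`oddKernel a x = ∑_{n∈ℤ}(n+a)e^{−π(n+a)²x}`, `sinKernel a x = ∑_{n≥1} 2n sin(2πna)e^{−πn²x}`), Ch. VII nº7 (iii) ("`(Sⁿ, can)` and
`(RPⁿ, can)` … are locally isometric" — the twisted trace carries no power terms).
B.-Y. Chen, *Total Mean Curvature and Submanifolds of Finite Type*, 2nd ed. (2014), §3.5 Proposition 3.9 (held text, chunk
p0071: "proper functions of `RPⁿ` are obtained from harmonic homogeneous polynomials of even degree") — the context: the
antipodal twist `(−1)^l` on the spectrum of `S^{2m}`.

## The computation

(1) `T_k(t) := ∑_{n≥0}(−1)ⁿ(2n+1)^{2k+1}e^{−t(n+½)²}` converges absolutely and `T_k′ = −¼T_{k+1}` on `(0, ∞)` (termwise;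
`(2n+1)^{2k+1}·(n+½)² = ¼(2n+1)^{2k+3}`, dominated on `(t₀/2, ∞)`). `Θ_i(y) := ∑_{n∈ℤ}(n+¼)^{2i+1}e^{−y(n+¼)²}` converges
absolutely (`|x|ᵖ ≤ 1 + (x²)ᵖ`, `(x²)ᵖe^{−yx²} ≤ p!(2/y)ᵖe^{−(y/2)x²}`) and `Θ_i′ = −Θ_{i+1}`. (2) `k = 0`: `t(n+½)² = t·n(n+1) +
t/4`, so `T_0(t) = e^{−t/4}·½e^{t/4}sinKernel(¼)(t/4π) = ½sinKernel(¼)(t/4π) = ½(4π/t)^{3/2}oddKernel(¼)(4π/t) =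
½(4π)^{3/2}t^{−3/2}Θ_0(4π²/t)`. (3) Differentiating, `d/dt[t^{−a}Θ_i(4π²/t)] = −a·t^{−(a+1)}Θ_i(4π²/t) + 4π²t^{−(a+2)}Θ_{i+1}(4π²/t)`
and `T_{k+1} = −4T_k′`: by induction `T_k(t) = ∑_{i≤k} c_{k,i}t^{−(k+3/2+i)}Θ_i(4π²/t)` with `c_{0,0} = ½(4π)^{3/2}`,
`c_{k+1,i} = 4(k+3/2+i)c_{k,i}[i ≤ k] − 16π²c_{k,i−1}[i ≥ 1]`. (4) `(n+¼)² ≥ 1/16` for every integer `n`, so for `y ≥ 1`: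
`|Θ_i(y)| ≤ ∑|n+¼|^{2i+1}e^{−(y−1)(n+¼)²}e^{−(n+¼)²} ≤ e^{−(y−1)/16}·M_i`, `M_i = ∑_{n∈ℤ}|n+¼|^{2i+1}e^{−(n+¼)²}`. (5) Hence for
`0 < t ≤ 4π²`: `|T_k(t)| ≤ ∑ᵢ|c_{k,i}|M_i e^{1/16}·t^{−(k+3/2+i)}e^{−π²/(4t)}`, and `t^{−a}e^{−π²/(4t)} = O(t^β)` for every `β`.

## What is proved

* §1 `summable_alternatingOddPow_mul_exp`, **`hasDerivAt_tsum_alternatingOddPow_mul_exp`** (`T_k′ = −¼T_{k+1}`),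
  `summable_abs_intCast_add_pow_mul_exp` (every shift `a`, every power), `summable_intCast_add_quarter_oddPow_mul_exp`,
  **`hasDerivAt_tsum_intCast_add_quarter_oddPow_mul_exp`** (`Θ_i′ = −Θ_{i+1}`); private `sq_pow_mul_exp_neg_mul_sq_le`,
  `abs_pow_le_one_add_sq_pow`.
* §2 **`tsum_alternating_mul_exp_neg_mul_add_half_sq_eq`** (`T_0(t) = ½(4π)^{3/2}t^{−3/2}Θ_0(4π²/t)`: the twisted Jacobi
  transformation, from Mathlib's kernels).
* §3 **`exists_tsum_alternatingOddPow_mul_exp_eq`** (THE RECIPROCITY FOR EVERY `k`).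
* §4 private `sixteenth_le_sq_intCast_add_quarter`, **`abs_tsum_intCast_add_quarter_oddPow_mul_exp_le`** (`|Θ_i(y)| ≤ e^{−(y−1)/16}M_i`).
* §5 **`isBigO_tsum_alternatingOddPow_mul_exp`** (`T_k = O(t^β)`, EVERY `k`, EVERY `β`),
  **`isBigO_tsum_alternating_oddPoly_mul_exp`** (odd polynomial weights `∑_{k<m}q_k(2n+1)^{2k+1}`).

## References

* [Berard1986] P. H. Bérard, *Spectral Geometry: Direct and Inverse Problems*, LNM 1207, Springer (1986), Ch. V nº6 (ii),
  Ch. VII nº7 (iii).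
* [Chen2014] B.-Y. Chen, *Total Mean Curvature and Submanifolds of Finite Type*, 2nd ed., World Scientific (2014), §3.5
  Proposition 3.9.
-/

noncomputable section

open Real Filter Topology Set Asymptotics HurwitzZeta

namespace Literature.Analysis.InnerProduct

/-! ### §1 The two families: `T_k(t) = ∑_{n≥0}(−1)ⁿ(2n+1)^{2k+1}e^{−t(n+½)²}` (`T_k′ = −¼T_{k+1}`) and
`Θ_i(y) = ∑_{n∈ℤ}(n+¼)^{2i+1}e^{−y(n+¼)²}` (`Θ_i′ = −Θ_{i+1}`) -/

/-- **Absolute convergence of the alternating sums** `∑_{n≥0}(−1)ⁿ(2n+1)ᵖe^{−t(n+½)²}`, `t > 0`. [cite: Berard1986, Ch. V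
nº6 (ii) (theta series)] -/
theorem summable_alternatingOddPow_mul_exp (p : ℕ) {t : ℝ} (ht : 0 < t) :
    Summable fun n : ℕ ↦ (-1 : ℝ) ^ n * (2 * (n : ℝ) + 1) ^ p * rexp (-(t * ((n : ℝ) + 1 / 2) ^ 2)) := by
  refine Summable.of_norm_bounded (summable_odd_pow_mul_exp_neg_mul_add_half_sq p ht) fun n ↦ ?_
  rw [Real.norm_eq_abs, abs_mul, abs_mul, abs_pow, abs_pow, abs_neg, abs_one, one_pow, one_mul,
    abs_of_nonneg (by positivity : (0 : ℝ) ≤ 2 * (n : ℝ) + 1), abs_of_nonneg (Real.exp_pos _).le]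

/-- **`T_k′ = −¼T_{k+1}` on `(0, ∞)`**: `d/dt ∑_{n≥0}(−1)ⁿ(2n+1)^{2k+1}e^{−t(n+½)²} = −¼∑_{n≥0}(−1)ⁿ(2n+1)^{2k+3}e^{−t(n+½)²}`
(termwise differentiation, dominated on `(t/2, ∞)`; `(n+½)² = ¼(2n+1)²`). [cite: Berard1986, Ch. V nº6 (ii)] -/
theorem hasDerivAt_tsum_alternatingOddPow_mul_exp (k : ℕ) {t : ℝ} (ht : 0 < t) :
    HasDerivAt (fun s : ℝ ↦ ∑' n : ℕ, (-1 : ℝ) ^ n * (2 * (n : ℝ) + 1) ^ (2 * k + 1) * rexp (-(s * ((n : ℝ) + 1 / 2) ^ 2)))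
      (-(1 / 4 * ∑' n : ℕ, (-1 : ℝ) ^ n * (2 * (n : ℝ) + 1) ^ (2 * (k + 1) + 1) * rexp (-(t * ((n : ℝ) + 1 / 2) ^ 2)))) t := by
  have ht2 : 0 < t / 2 := half_pos ht
  have hderiv : ∀ (n : ℕ) (y : ℝ), HasDerivAt
      (fun s : ℝ ↦ (-1 : ℝ) ^ n * (2 * (n : ℝ) + 1) ^ (2 * k + 1) * rexp (-(s * ((n : ℝ) + 1 / 2) ^ 2)))
      (-(1 / 4 * ((-1 : ℝ) ^ n * (2 * (n : ℝ) + 1) ^ (2 * (k + 1) + 1) * rexp (-(y * ((n : ℝ) + 1 / 2) ^ 2))))) y := by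
    intro n y
    have h1 : HasDerivAt (fun s : ℝ ↦ -(s * ((n : ℝ) + 1 / 2) ^ 2)) (-(1 * ((n : ℝ) + 1 / 2) ^ 2)) y :=
      ((hasDerivAt_id' y).mul_const _).neg
    refine (h1.exp.const_mul ((-1 : ℝ) ^ n * (2 * (n : ℝ) + 1) ^ (2 * k + 1))).congr_deriv ?_
    rw [show 2 * (k + 1) + 1 = 2 * k + 1 + 2 by ring, pow_add]
    ring
  have h := hasDerivAt_tsum_of_isPreconnected (𝕜 := ℝ) (F := ℝ)
    (u := fun n : ℕ ↦ 1 / 4 * ((2 * (n : ℝ) + 1) ^ (2 * (k + 1) + 1) * rexp (-(t / 2 * ((n : ℝ) + 1 / 2) ^ 2))))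
    (g := fun (n : ℕ) (s : ℝ) ↦ (-1 : ℝ) ^ n * (2 * (n : ℝ) + 1) ^ (2 * k + 1) * rexp (-(s * ((n : ℝ) + 1 / 2) ^ 2)))
    (g' := fun (n : ℕ) (y : ℝ) ↦
      -(1 / 4 * ((-1 : ℝ) ^ n * (2 * (n : ℝ) + 1) ^ (2 * (k + 1) + 1) * rexp (-(y * ((n : ℝ) + 1 / 2) ^ 2)))))
    (t := Ioi (t / 2)) (y₀ := t) (y := t)
    ((summable_odd_pow_mul_exp_neg_mul_add_half_sq (2 * (k + 1) + 1) ht2).mul_left _) isOpen_Ioi isPreconnected_Ioi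
    (fun n y _ ↦ hderiv n y) ?_ (half_lt_self ht) (summable_alternatingOddPow_mul_exp (2 * k + 1) ht) (half_lt_self ht)
  · rw [tsum_neg, tsum_mul_left] at h
    exact h
  · intro n y hy
    have hy' : t / 2 < y := hy
    rw [norm_neg, norm_mul, Real.norm_of_nonneg (by norm_num : (0 : ℝ) ≤ 1 / 4), Real.norm_eq_abs, abs_mul, abs_mul,
      abs_pow, abs_pow, abs_neg, abs_one, one_pow, one_mul, abs_of_nonneg (by positivity : (0 : ℝ) ≤ 2 * (n : ℝ) + 1),
      abs_of_nonneg (Real.exp_pos _).le]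
    refine mul_le_mul_of_nonneg_left (mul_le_mul_of_nonneg_left (Real.exp_le_exp.mpr ?_) (by positivity)) (by norm_num)
    nlinarith [sq_nonneg ((n : ℝ) + 1 / 2)]

/-- `(x²)ʲe^{−tx²} ≤ j!(2/t)ʲe^{−(t/2)x²}` for `t > 0` (`(tx²/2)ʲ/j! ≤ e^{tx²/2}`). [folklore] -/
private theorem sq_pow_mul_exp_neg_mul_sq_le (j : ℕ) (x : ℝ) {t : ℝ} (ht : 0 < t) :
    (x ^ 2) ^ j * rexp (-(t * x ^ 2)) ≤ (Nat.factorial j : ℝ) * (2 / t) ^ j * rexp (-(t / 2 * x ^ 2)) := by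
  have h0 : 0 ≤ t / 2 * x ^ 2 := by positivity
  have hj : (0 : ℝ) < Nat.factorial j := by exact_mod_cast Nat.factorial_pos j
  have h1 : (t / 2 * x ^ 2) ^ j / (Nat.factorial j : ℝ) ≤ rexp (t / 2 * x ^ 2) :=
    Real.pow_div_factorial_le_exp _ h0 j
  rw [div_le_iff₀ hj, mul_pow] at h1
  have h2 : (x ^ 2) ^ j ≤ (Nat.factorial j : ℝ) * (2 / t) ^ j * rexp (t / 2 * x ^ 2) := by
    have e : (x ^ 2) ^ j = (2 / t) ^ j * ((t / 2) ^ j * (x ^ 2) ^ j) := by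
      rw [← mul_assoc, ← mul_pow, show 2 / t * (t / 2) = 1 by field_simp, one_pow, one_mul]
    rw [e]
    calc (2 / t) ^ j * ((t / 2) ^ j * (x ^ 2) ^ j) ≤ (2 / t) ^ j * (rexp (t / 2 * x ^ 2) * Nat.factorial j) := by
          gcongr
      _ = (Nat.factorial j : ℝ) * (2 / t) ^ j * rexp (t / 2 * x ^ 2) := by ring
  calc (x ^ 2) ^ j * rexp (-(t * x ^ 2))
      ≤ (Nat.factorial j : ℝ) * (2 / t) ^ j * rexp (t / 2 * x ^ 2) * rexp (-(t * x ^ 2)) := by gcongr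
    _ = (Nat.factorial j : ℝ) * (2 / t) ^ j * rexp (-(t / 2 * x ^ 2)) := by
        rw [mul_assoc, ← Real.exp_add]; ring_nf

/-- `|x|ᵖ ≤ 1 + (x²)ᵖ` (`|x| ≤ 1` or `|x|ᵖ ≤ |x|^{2p}`). [folklore] -/
private theorem abs_pow_le_one_add_sq_pow (x : ℝ) (p : ℕ) : |x| ^ p ≤ 1 + (x ^ 2) ^ p := by
  have hsq : 0 ≤ (x ^ 2) ^ p := by positivity
  rcases le_or_gt |x| 1 with h | h
  · have : |x| ^ p ≤ 1 := pow_le_one₀ (abs_nonneg x) h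
    linarith
  · have h1 : |x| ^ p ≤ |x| ^ (2 * p) := pow_le_pow_right₀ h.le (by omega)
    rw [pow_mul, sq_abs] at h1
    linarith

/-- **Absolute convergence of the shifted power-weighted theta series** `∑_{n∈ℤ}|n+a|ᵖe^{−y(n+a)²}`, `y > 0`, every real
shift `a` and every `p`. [cite: Berard1986, Ch. V nº6 (ii)] -/
theorem summable_abs_intCast_add_pow_mul_exp (a : ℝ) (p : ℕ) {y : ℝ} (hy : 0 < y) :
    Summable fun n : ℤ ↦ |(n : ℝ) + a| ^ p * rexp (-(y * ((n : ℝ) + a) ^ 2)) := by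
  have h1 := summable_exp_neg_mul_intCast_add_sq a hy
  have h2 := (summable_exp_neg_mul_intCast_add_sq a (half_pos hy)).mul_left ((Nat.factorial p : ℝ) * (2 / y) ^ p)
  refine (h1.add h2).of_nonneg_of_le (fun n ↦ by positivity) fun n ↦ ?_
  have hb := sq_pow_mul_exp_neg_mul_sq_le p ((n : ℝ) + a) hy
  have hx := abs_pow_le_one_add_sq_pow ((n : ℝ) + a) p
  have he : 0 ≤ rexp (-(y * ((n : ℝ) + a) ^ 2)) := (Real.exp_pos _).le
  calc |(n : ℝ) + a| ^ p * rexp (-(y * ((n : ℝ) + a) ^ 2))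
      ≤ (1 + (((n : ℝ) + a) ^ 2) ^ p) * rexp (-(y * ((n : ℝ) + a) ^ 2)) := mul_le_mul_of_nonneg_right hx he
    _ = rexp (-(y * ((n : ℝ) + a) ^ 2)) + (((n : ℝ) + a) ^ 2) ^ p * rexp (-(y * ((n : ℝ) + a) ^ 2)) := by ring
    _ ≤ rexp (-(y * ((n : ℝ) + a) ^ 2)) +
        (Nat.factorial p : ℝ) * (2 / y) ^ p * rexp (-(y / 2 * ((n : ℝ) + a) ^ 2)) := by linarith

/-- `Θ_i(y) = ∑_{n∈ℤ}(n+¼)^{2i+1}e^{−y(n+¼)²}` converges for `y > 0`. [cite: Berard1986, Ch. V nº6 (ii)] -/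
theorem summable_intCast_add_quarter_oddPow_mul_exp (i : ℕ) {y : ℝ} (hy : 0 < y) :
    Summable fun n : ℤ ↦ ((n : ℝ) + 1 / 4) ^ (2 * i + 1) * rexp (-(y * ((n : ℝ) + 1 / 4) ^ 2)) := by
  refine Summable.of_norm_bounded (summable_abs_intCast_add_pow_mul_exp (1 / 4) (2 * i + 1) hy) fun n ↦ ?_
  rw [Real.norm_eq_abs, abs_mul, abs_pow, abs_of_nonneg (Real.exp_pos _).le]

/-- **`Θ_i′ = −Θ_{i+1}` on `(0, ∞)`** (termwise differentiation, dominated on `(y/2, ∞)`). [cite: Berard1986, Ch. V nº6 (ii)] -/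
theorem hasDerivAt_tsum_intCast_add_quarter_oddPow_mul_exp (i : ℕ) {y : ℝ} (hy : 0 < y) :
    HasDerivAt (fun v : ℝ ↦ ∑' n : ℤ, ((n : ℝ) + 1 / 4) ^ (2 * i + 1) * rexp (-(v * ((n : ℝ) + 1 / 4) ^ 2)))
      (-(∑' n : ℤ, ((n : ℝ) + 1 / 4) ^ (2 * (i + 1) + 1) * rexp (-(y * ((n : ℝ) + 1 / 4) ^ 2)))) y := by
  have hy2 : 0 < y / 2 := half_pos hy
  have hderiv : ∀ (n : ℤ) (v : ℝ), HasDerivAt (fun v : ℝ ↦ ((n : ℝ) + 1 / 4) ^ (2 * i + 1) * rexp (-(v * ((n : ℝ) + 1 / 4) ^ 2)))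
      (-(((n : ℝ) + 1 / 4) ^ (2 * (i + 1) + 1) * rexp (-(v * ((n : ℝ) + 1 / 4) ^ 2)))) v := by
    intro n v
    have h1 : HasDerivAt (fun v : ℝ ↦ -(v * ((n : ℝ) + 1 / 4) ^ 2)) (-(1 * ((n : ℝ) + 1 / 4) ^ 2)) v :=
      ((hasDerivAt_id' v).mul_const _).neg
    refine (h1.exp.const_mul (((n : ℝ) + 1 / 4) ^ (2 * i + 1))).congr_deriv ?_
    rw [show 2 * (i + 1) + 1 = 2 * i + 1 + 2 by ring, pow_add]
    ring
  have h := hasDerivAt_tsum_of_isPreconnected (𝕜 := ℝ) (F := ℝ)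
    (u := fun n : ℤ ↦ |(n : ℝ) + 1 / 4| ^ (2 * (i + 1) + 1) * rexp (-(y / 2 * ((n : ℝ) + 1 / 4) ^ 2)))
    (g := fun (n : ℤ) (v : ℝ) ↦ ((n : ℝ) + 1 / 4) ^ (2 * i + 1) * rexp (-(v * ((n : ℝ) + 1 / 4) ^ 2)))
    (g' := fun (n : ℤ) (v : ℝ) ↦ -(((n : ℝ) + 1 / 4) ^ (2 * (i + 1) + 1) * rexp (-(v * ((n : ℝ) + 1 / 4) ^ 2))))
    (t := Ioi (y / 2)) (y₀ := y) (y := y) (summable_abs_intCast_add_pow_mul_exp (1 / 4) (2 * (i + 1) + 1) hy2)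
    isOpen_Ioi isPreconnected_Ioi (fun n v _ ↦ hderiv n v) ?_ (half_lt_self hy)
    (summable_intCast_add_quarter_oddPow_mul_exp i hy) (half_lt_self hy)
  · rw [tsum_neg] at h
    exact h
  · intro n v hv
    have hv' : y / 2 < v := hv
    rw [norm_neg, Real.norm_eq_abs, abs_mul, abs_pow, abs_of_nonneg (Real.exp_pos _).le]
    refine mul_le_mul_of_nonneg_left (Real.exp_le_exp.mpr ?_) (by positivity)
    nlinarith [sq_nonneg ((n : ℝ) + 1 / 4)]

/-! ### §2 The twisted Jacobi transformation, `k = 0`: `T_0(t) = ½sinKernel(¼)(t/4π) = ½(4π)^{3/2}t^{−3/2}Θ_0(4π²/t)` -/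

/-- **`∑_{n≥0}(−1)ⁿ(2n+1)e^{−t(n+½)²} = ½(4π)^{3/2}t^{−3/2}∑_{n∈ℤ}(n+¼)e^{−(4π²/t)(n+¼)²}`** for `t > 0`: `t(n+½)² = t·n(n+1) +
t/4` and row g40-#2's `∑(−1)^l(2l+1)e^{−t·l(l+1)} = ½e^{t/4}sinKernel(¼)(t/4π)`, then Mathlib's `oddKernel a x =
x^{−3/2}sinKernel a (1/x)` at `x = 4π/t` and `oddKernel(¼)(x) = ∑_{n∈ℤ}(n+¼)e^{−π(n+¼)²x}`. [cite: Berard1986, Ch. V nº6 (ii)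
(Poisson summation ∕ Jacobi's transformation); Chen2014, §3.5 Proposition 3.9] -/
theorem tsum_alternating_mul_exp_neg_mul_add_half_sq_eq {t : ℝ} (ht : 0 < t) :
    ∑' n : ℕ, (-1 : ℝ) ^ n * (2 * (n : ℝ) + 1) ^ (2 * 0 + 1) * rexp (-(t * ((n : ℝ) + 1 / 2) ^ 2)) =
      1 / 2 * (4 * π) ^ (3 / 2 : ℝ) * t ^ (-(3 / 2 : ℝ)) *
        ∑' n : ℤ, ((n : ℝ) + 1 / 4) ^ (2 * 0 + 1) * rexp (-(4 * π ^ 2 / t * ((n : ℝ) + 1 / 4) ^ 2)) := by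
  have hπ := Real.pi_pos
  have hx : 0 < 4 * π / t := by positivity
  -- `T_0(t) = e^{−t/4}·∑(−1)^l(2l+1)e^{−t·l(l+1)} = ½ sinKernel(¼)(t/4π)`
  have h1 : ∑' n : ℕ, (-1 : ℝ) ^ n * (2 * (n : ℝ) + 1) ^ (2 * 0 + 1) * rexp (-(t * ((n : ℝ) + 1 / 2) ^ 2)) =
      rexp (-(t / 4)) * ∑' l : ℕ, (-1 : ℝ) ^ l * (2 * (l : ℝ) + 1) * rexp (-(t * ((l : ℝ) * (l + 1)))) := by
    rw [← tsum_mul_left]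
    refine tsum_congr fun n ↦ ?_
    rw [show 2 * 0 + 1 = 1 from rfl, pow_one,
      show rexp (-(t * ((n : ℝ) + 1 / 2) ^ 2)) = rexp (-(t / 4)) * rexp (-(t * ((n : ℝ) * (n + 1)))) by
        rw [← Real.exp_add]; congr 1; ring]
    ring
  rw [h1, tsum_twoSphere_twisted ht]
  -- the functional equation at `x = 4π/t`
  have hfe := oddKernel_functional_equation ((1 / 4 : ℝ) : UnitAddCircle) (4 * π / t)
  rw [one_div_div] at hfe
  have hxp : 0 < (4 * π / t) ^ (3 / 2 : ℝ) := Real.rpow_pos_of_pos hx _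
  have hS : sinKernel ((1 / 4 : ℝ) : UnitAddCircle) (t / (4 * π)) =
      (4 * π / t) ^ (3 / 2 : ℝ) * oddKernel ((1 / 4 : ℝ) : UnitAddCircle) (4 * π / t) := by
    rw [hfe]
    field_simp
  rw [hS, ← (hasSum_int_oddKernel (1 / 4) hx).tsum_eq, Real.div_rpow (by positivity) ht.le, Real.rpow_neg ht.le]
  have e2 : ∑' n : ℤ, ((n : ℝ) + 1 / 4) * rexp (-π * ((n : ℝ) + 1 / 4) ^ 2 * (4 * π / t)) =
      ∑' n : ℤ, ((n : ℝ) + 1 / 4) ^ (2 * 0 + 1) * rexp (-(4 * π ^ 2 / t * ((n : ℝ) + 1 / 4) ^ 2)) :=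
    tsum_congr fun n ↦ by
      rw [show 2 * 0 + 1 = 1 from rfl, pow_one]
      congr 2
      field_simp
  rw [e2]
  have hee : rexp (-(t / 4)) * rexp (t / 4) = 1 := by rw [← Real.exp_add]; simp
  have htp : t ^ (3 / 2 : ℝ) ≠ 0 := (Real.rpow_pos_of_pos ht _).ne'
  calc rexp (-(t / 4)) * (rexp (t / 4) / 2 * ((4 * π) ^ (3 / 2 : ℝ) / t ^ (3 / 2 : ℝ) *
        ∑' n : ℤ, ((n : ℝ) + 1 / 4) ^ (2 * 0 + 1) * rexp (-(4 * π ^ 2 / t * ((n : ℝ) + 1 / 4) ^ 2))))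
      = rexp (-(t / 4)) * rexp (t / 4) * (1 / 2 * (4 * π) ^ (3 / 2 : ℝ) * (t ^ (3 / 2 : ℝ))⁻¹ *
        ∑' n : ℤ, ((n : ℝ) + 1 / 4) ^ (2 * 0 + 1) * rexp (-(4 * π ^ 2 / t * ((n : ℝ) + 1 / 4) ^ 2))) := by
        rw [div_eq_mul_inv _ (t ^ (3 / 2 : ℝ))]; ring
    _ = _ := by rw [hee, one_mul]

/-! ### §3 The reciprocity for every `k`: `T_k(t) = ∑_{i≤k} c_{k,i}t^{−(k+3/2+i)}Θ_i(4π²/t)` -/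

/-- **THE RECIPROCITY FORMULA FOR THE ALTERNATING ODD-POWER SUMS**: for every `k` there are real constants `c_{k,0}, …, c_{k,k}`
with, for all `t > 0`,
`∑_{n≥0}(−1)ⁿ(2n+1)^{2k+1}e^{−t(n+½)²} = ∑_{i=0}^{k} c_{k,i} t^{−(k+3/2+i)} ∑_{n∈ℤ}(n+¼)^{2i+1}e^{−(4π²/t)(n+¼)²}`
— the twisted Jacobi transformation (`k = 0`, `c_{0,0} = ½(4π)^{3/2}`) differentiated `k` times (`T_{k+1} = −4T_k′`,
`Θ_i′ = −Θ_{i+1}`; `c_{k+1,i} = 4(k+3/2+i)c_{k,i} − 16π²c_{k,i−1}`). [cite: Berard1986, Ch. V nº6 (ii) (Jacobi's transformation ∕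
Poisson summation)] -/
theorem exists_tsum_alternatingOddPow_mul_exp_eq (k : ℕ) :
    ∃ c : ℕ → ℝ, ∀ t : ℝ, 0 < t →
      ∑' n : ℕ, (-1 : ℝ) ^ n * (2 * (n : ℝ) + 1) ^ (2 * k + 1) * rexp (-(t * ((n : ℝ) + 1 / 2) ^ 2)) =
        ∑ i ∈ Finset.range (k + 1), c i * t ^ (-((k : ℝ) + 3 / 2 + i)) *
          ∑' n : ℤ, ((n : ℝ) + 1 / 4) ^ (2 * i + 1) * rexp (-(4 * π ^ 2 / t * ((n : ℝ) + 1 / 4) ^ 2)) := by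
  set T : ℕ → ℝ → ℝ := fun j s ↦
    ∑' n : ℕ, (-1 : ℝ) ^ n * (2 * (n : ℝ) + 1) ^ (2 * j + 1) * rexp (-(s * ((n : ℝ) + 1 / 2) ^ 2)) with hT
  set Θ : ℕ → ℝ → ℝ := fun i v ↦ ∑' n : ℤ, ((n : ℝ) + 1 / 4) ^ (2 * i + 1) * rexp (-(v * ((n : ℝ) + 1 / 4) ^ 2)) with hΘ
  have hTd : ∀ (j : ℕ) (s : ℝ), 0 < s → HasDerivAt (T j) (-(1 / 4 * T (j + 1) s)) s := fun j s hs ↦ by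
    simpa only [hT] using hasDerivAt_tsum_alternatingOddPow_mul_exp j hs
  have hΘd : ∀ (i : ℕ) (v : ℝ), 0 < v → HasDerivAt (Θ i) (-Θ (i + 1) v) v := fun i v hv ↦ by
    simpa only [hΘ] using hasDerivAt_tsum_intCast_add_quarter_oddPow_mul_exp i hv
  set C : ℝ := 4 * π ^ 2 with hC
  have hC0 : 0 < C := by positivity
  induction k with
  | zero =>
    refine ⟨fun _ ↦ 1 / 2 * (4 * π) ^ (3 / 2 : ℝ), fun t ht ↦ ?_⟩
    rw [Finset.sum_range_one, hC]
    convert tsum_alternating_mul_exp_neg_mul_add_half_sq_eq ht using 2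
    norm_num
  | succ k ih =>
    obtain ⟨c, hc⟩ := ih
    have hc' : ∀ s : ℝ, 0 < s →
        T k s = ∑ i ∈ Finset.range (k + 1), c i * s ^ (-((k : ℝ) + 3 / 2 + i)) * Θ i (C / s) := fun s hs ↦ by
      simpa only [hT, hΘ, hC] using hc s hs
    -- the new coefficients
    set c' : ℕ → ℝ := fun i ↦
      (if i ≤ k then 4 * ((k : ℝ) + 3 / 2 + i) * c i else 0) - (if i = 0 then 0 else 4 * C * c (i - 1)) with hc'def
    refine ⟨c', fun t ht ↦ ?_⟩
    -- differentiate the order-`k` identity at `t`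
    have hinner : HasDerivAt (fun s : ℝ ↦ C / s) (-C / t ^ 2) t := by
      have h := (hasDerivAt_inv ht.ne').const_mul C
      have e : (fun s : ℝ ↦ C / s) = fun s ↦ C * s⁻¹ := by funext s; rw [div_eq_mul_inv]
      rw [e]
      exact h.congr_deriv (by ring)
    have hX : ∀ i : ℕ, HasDerivAt (fun s : ℝ ↦ Θ i (C / s)) (-Θ (i + 1) (C / t) * (-C / t ^ 2)) t :=
      fun i ↦ (hΘd i (C / t) (by positivity)).comp t hinner
    have hP : ∀ i : ℕ, HasDerivAt (fun s : ℝ ↦ s ^ (-((k : ℝ) + 3 / 2 + i)))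
        (-((k : ℝ) + 3 / 2 + i) * t ^ (-((k : ℝ) + 3 / 2 + i) - 1)) t :=
      fun i ↦ Real.hasDerivAt_rpow_const (Or.inl ht.ne')
    have key : ∀ i ∈ Finset.range (k + 1), HasDerivAt (fun s : ℝ ↦ c i * (s ^ (-((k : ℝ) + 3 / 2 + i)) * Θ i (C / s)))
        (-(((k : ℝ) + 3 / 2 + i) * c i * (t ^ (-(((k + 1 : ℕ) : ℝ) + 3 / 2 + (i : ℝ))) * Θ i (C / t))) +
          C * c i * (t ^ (-(((k + 1 : ℕ) : ℝ) + 3 / 2 + ((i + 1 : ℕ) : ℝ))) * Θ (i + 1) (C / t))) t := by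
      intro i _
      have h := ((hP i).mul (hX i)).const_mul (c i)
      refine h.congr_deriv ?_
      have e1 : t ^ (-((k : ℝ) + 3 / 2 + i) - 1) = t ^ (-(((k + 1 : ℕ) : ℝ) + 3 / 2 + (i : ℝ))) := by
        congr 1; push_cast; ring
      have e2 : t ^ (-((k : ℝ) + 3 / 2 + i)) * (-Θ (i + 1) (C / t) * (-C / t ^ 2)) =
          C * (t ^ (-(((k + 1 : ℕ) : ℝ) + 3 / 2 + ((i + 1 : ℕ) : ℝ))) * Θ (i + 1) (C / t)) := by
        rw [show -(((k + 1 : ℕ) : ℝ) + 3 / 2 + ((i + 1 : ℕ) : ℝ)) = -((k : ℝ) + 3 / 2 + i) - 2 by push_cast; ring,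
          Real.rpow_sub ht, Real.rpow_two]
        field_simp
      rw [mul_add, e2, e1]
      ring
    have hsum := HasDerivAt.fun_sum key
    have hEq : T k =ᶠ[𝓝 t]
        fun s : ℝ ↦ ∑ i ∈ Finset.range (k + 1), c i * (s ^ (-((k : ℝ) + 3 / 2 + i)) * Θ i (C / s)) := by
      filter_upwards [Ioi_mem_nhds ht] with s (hs : 0 < s)
      rw [hc' s hs]
      exact Finset.sum_congr rfl fun i _ ↦ mul_assoc _ _ _
    have hTk := hsum.congr_of_eventuallyEq hEq
    have huniq := (hTd k t ht).unique hTk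
    -- `T_{k+1}(t) = −4·T_k′(t) = ∑ (4A_i − 4B_i)`
    have hsolve : T (k + 1) t = ∑ i ∈ Finset.range (k + 1),
        (4 * ((k : ℝ) + 3 / 2 + i) * c i * (t ^ (-(((k + 1 : ℕ) : ℝ) + 3 / 2 + (i : ℝ))) * Θ i (C / t)) -
          4 * C * c i * (t ^ (-(((k + 1 : ℕ) : ℝ) + 3 / 2 + ((i + 1 : ℕ) : ℝ))) * Θ (i + 1) (C / t))) := by
      have e : ∑ i ∈ Finset.range (k + 1),
          (4 * ((k : ℝ) + 3 / 2 + i) * c i * (t ^ (-(((k + 1 : ℕ) : ℝ) + 3 / 2 + (i : ℝ))) * Θ i (C / t)) -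
            4 * C * c i * (t ^ (-(((k + 1 : ℕ) : ℝ) + 3 / 2 + ((i + 1 : ℕ) : ℝ))) * Θ (i + 1) (C / t))) =
          -4 * ∑ i ∈ Finset.range (k + 1),
            (-(((k : ℝ) + 3 / 2 + i) * c i * (t ^ (-(((k + 1 : ℕ) : ℝ) + 3 / 2 + (i : ℝ))) * Θ i (C / t))) +
              C * c i * (t ^ (-(((k + 1 : ℕ) : ℝ) + 3 / 2 + ((i + 1 : ℕ) : ℝ))) * Θ (i + 1) (C / t))) := by
        rw [Finset.mul_sum]
        exact Finset.sum_congr rfl fun i _ ↦ by ring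
      rw [e, ← huniq]
      ring
    -- regroup: peel `i = k+1` off the first half and `i = 0` off the second half
    have hA : ∑ i ∈ Finset.range (k + 1 + 1), (if i ≤ k then 4 * ((k : ℝ) + 3 / 2 + i) * c i else 0) *
        (t ^ (-(((k + 1 : ℕ) : ℝ) + 3 / 2 + (i : ℝ))) * Θ i (C / t)) =
        ∑ i ∈ Finset.range (k + 1),
          4 * ((k : ℝ) + 3 / 2 + i) * c i * (t ^ (-(((k + 1 : ℕ) : ℝ) + 3 / 2 + (i : ℝ))) * Θ i (C / t)) := by
      rw [Finset.sum_range_succ, if_neg (by omega), zero_mul, add_zero]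
      refine Finset.sum_congr rfl fun i hi ↦ ?_
      rw [if_pos (Nat.lt_succ_iff.mp (Finset.mem_range.mp hi))]
    have hB : ∑ i ∈ Finset.range (k + 1 + 1), (if i = 0 then 0 else 4 * C * c (i - 1)) *
        (t ^ (-(((k + 1 : ℕ) : ℝ) + 3 / 2 + (i : ℝ))) * Θ i (C / t)) =
        ∑ i ∈ Finset.range (k + 1),
          4 * C * c i * (t ^ (-(((k + 1 : ℕ) : ℝ) + 3 / 2 + ((i + 1 : ℕ) : ℝ))) * Θ (i + 1) (C / t)) := by
      rw [Finset.sum_range_succ', if_pos rfl, zero_mul, add_zero]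
      refine Finset.sum_congr rfl fun i _ ↦ ?_
      rw [if_neg (Nat.succ_ne_zero i), Nat.add_sub_cancel]
    have hfinal : T (k + 1) t = ∑ i ∈ Finset.range (k + 1 + 1),
        c' i * t ^ (-(((k + 1 : ℕ) : ℝ) + 3 / 2 + (i : ℝ))) * Θ i (C / t) := by
      rw [hsolve, Finset.sum_sub_distrib, ← hA, ← hB, ← Finset.sum_sub_distrib]
      refine Finset.sum_congr rfl fun i _ ↦ ?_
      simp only [hc'def]
      ring
    simpa only [hT, hΘ, hC] using hfinal

/-! ### §4 The dual series are exponentially small: `|Θ_i(y)| ≤ e^{−(y−1)/16}·∑_{n∈ℤ}|n+¼|^{2i+1}e^{−(n+¼)²}` for `y ≥ 1` -/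

/-- `(n+¼)² ≥ 1/16` for every integer `n` (the dual lattice `ℤ + ¼` avoids `0`). [folklore] -/
private theorem sixteenth_le_sq_intCast_add_quarter (n : ℤ) : (1 / 16 : ℝ) ≤ ((n : ℝ) + 1 / 4) ^ 2 := by
  rcases le_or_gt 0 n with h | h
  · have h' : (0 : ℝ) ≤ n := by exact_mod_cast h
    nlinarith
  · have h' : (n : ℝ) ≤ -1 := by exact_mod_cast (Int.le_sub_one_of_lt h)
    nlinarith

/-- **`|Θ_i(y)| ≤ e^{−(y−1)/16}·M_i` for `y ≥ 1`, `M_i = ∑_{n∈ℤ}|n+¼|^{2i+1}e^{−(n+¼)²}`** (`e^{−y(n+¼)²} =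
e^{−(y−1)(n+¼)²}e^{−(n+¼)²} ≤ e^{−(y−1)/16}e^{−(n+¼)²}`): every term of the dual series is exponentially small. [cite:
Berard1986, Ch. V nº6 (ii), nº7] -/
theorem abs_tsum_intCast_add_quarter_oddPow_mul_exp_le (i : ℕ) {y : ℝ} (hy : 1 ≤ y) :
    |∑' n : ℤ, ((n : ℝ) + 1 / 4) ^ (2 * i + 1) * rexp (-(y * ((n : ℝ) + 1 / 4) ^ 2))| ≤
      rexp (-((y - 1) / 16)) * ∑' n : ℤ, |(n : ℝ) + 1 / 4| ^ (2 * i + 1) * rexp (-(1 * ((n : ℝ) + 1 / 4) ^ 2)) := by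
  have hM := summable_abs_intCast_add_pow_mul_exp (1 / 4) (2 * i + 1) one_pos
  rw [← Real.norm_eq_abs]
  refine tsum_of_norm_bounded (hM.hasSum.mul_left (rexp (-((y - 1) / 16)))) fun n ↦ ?_
  rw [Real.norm_eq_abs, abs_mul, abs_pow, abs_of_nonneg (Real.exp_pos _).le, mul_left_comm]
  refine mul_le_mul_of_nonneg_left ?_ (by positivity)
  rw [← Real.exp_add]
  refine Real.exp_le_exp.mpr ?_
  have hq := sixteenth_le_sq_intCast_add_quarter n
  nlinarith [mul_le_mul_of_nonneg_left hq (sub_nonneg.mpr hy)]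

/-! ### §5 `T_k(t) = O(t^β)` for every `k` and every `β`; odd polynomial weights -/

/-- **THE ALTERNATING ODD-POWER THETA SUMS ARE `O(t^∞)`: `∑_{n≥0}(−1)ⁿ(2n+1)^{2k+1}e^{−t(n+½)²} = O(t^β)` as `t → 0⁺`, for
EVERY `k ∈ ℕ` and EVERY real `β`** — by the reciprocity of §3 and the bound of §4,
`T_k(t) = O(t^{−(2k+3/2)}e^{−π²/(4t)})`. (`k = 0`: row g40-#2's `isBigO_twoSphere_twisted`, the antipodal-twisted trace of
`S²`.) The even-dimensional twisted traces `Tr((−1)^l e^{−tΔ_{S^{2m}}})` are finite combinations of these (row g41-#2's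
multiplicities `u·p_m(u²)`), hence `O(t^∞)`: "`(Sⁿ, can)` and `(RPⁿ, can)` … are locally isometric". [cite: Berard1986, Ch. V
nº6 (ii) and Ch. VII nº7 (iii); Chen2014, §3.5 Proposition 3.9] -/
theorem isBigO_tsum_alternatingOddPow_mul_exp (k : ℕ) (β : ℝ) :
    (fun t : ℝ ↦ ∑' n : ℕ, (-1 : ℝ) ^ n * (2 * (n : ℝ) + 1) ^ (2 * k + 1) * rexp (-(t * ((n : ℝ) + 1 / 2) ^ 2)))
      =O[𝓝[>] 0] fun t : ℝ ↦ t ^ β := by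
  obtain ⟨c, hc⟩ := exists_tsum_alternatingOddPow_mul_exp_eq k
  set Θ : ℕ → ℝ → ℝ := fun i v ↦ ∑' n : ℤ, ((n : ℝ) + 1 / 4) ^ (2 * i + 1) * rexp (-(v * ((n : ℝ) + 1 / 4) ^ 2)) with hΘ
  have hC0 : 0 < 4 * π ^ 2 := by positivity
  have hc16 : 0 < 4 * π ^ 2 / 16 := by positivity
  -- Step 1: the sum as the finite combination of dual series
  have h1 : (fun t : ℝ ↦ ∑' n : ℕ, (-1 : ℝ) ^ n * (2 * (n : ℝ) + 1) ^ (2 * k + 1) * rexp (-(t * ((n : ℝ) + 1 / 2) ^ 2)))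
      =ᶠ[𝓝[>] 0] fun t : ℝ ↦ ∑ i ∈ Finset.range (k + 1), c i * t ^ (-((k : ℝ) + 3 / 2 + i)) * Θ i (4 * π ^ 2 / t) := by
    filter_upwards [self_mem_nhdsWithin] with t (ht : 0 < t)
    simpa only [hΘ] using hc t ht
  refine h1.trans_isBigO (IsBigO.sum fun i _ ↦ ?_)
  -- Step 2: each dual series is exponentially small
  have hrem : (fun t : ℝ ↦ Θ i (4 * π ^ 2 / t)) =O[𝓝[>] 0] fun t : ℝ ↦ rexp (-(4 * π ^ 2 / 16 / t)) := by
    refine IsBigO.of_bound ((∑' n : ℤ, |(n : ℝ) + 1 / 4| ^ (2 * i + 1) * rexp (-(1 * ((n : ℝ) + 1 / 4) ^ 2))) *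
      rexp (1 / 16)) ?_
    filter_upwards [Ioc_mem_nhdsGT hC0] with t ht
    have hu : 1 ≤ 4 * π ^ 2 / t := by rw [le_div_iff₀ ht.1]; linarith [ht.2]
    have hb := abs_tsum_intCast_add_quarter_oddPow_mul_exp_le i hu
    rw [Real.norm_eq_abs, Real.norm_of_nonneg (Real.exp_pos _).le]
    refine hb.trans (le_of_eq ?_)
    rw [show -((4 * π ^ 2 / t - 1) / 16) = 1 / 16 + -(4 * π ^ 2 / 16 / t) by ring, Real.exp_add]
    ring
  -- Step 3: `e^{−π²/(4t)}` beats every power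
  have h4 : ∀ γ : ℝ, (fun t : ℝ ↦ t ^ γ * rexp (-(4 * π ^ 2 / 16 / t))) =O[𝓝[>] 0] fun t : ℝ ↦ t ^ β := by
    intro γ
    have h := (isBigO_refl (fun t : ℝ ↦ t ^ γ) (𝓝[>] 0)).mul (isBigO_exp_neg_div_nhdsGT hc16 (β - γ))
    refine h.trans ?_
    refine (isBigO_refl _ _).congr' ?_ EventuallyEq.rfl
    filter_upwards [self_mem_nhdsWithin] with t (ht : 0 < t)
    rw [← Real.rpow_add ht]; ring_nf
  have h5 := (((isBigO_refl (fun t : ℝ ↦ t ^ (-((k : ℝ) + 3 / 2 + i))) (𝓝[>] 0)).mul hrem).trans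
    (h4 _)).const_mul_left (c i)
  refine h5.congr' ?_ EventuallyEq.rfl
  filter_upwards with t
  ring

/-- **ODD POLYNOMIAL WEIGHTS: `∑_{n≥0}(−1)ⁿ(∑_{k<m} q_k(2n+1)^{2k+1})e^{−t(n+½)²} = O(t^β)`** for every coefficient vector `q`,
every `m` and every `β` — the form in which the twisted traces of the even spheres appear (weights `u·p_m(u²)`, `u = 2n+1`).
[cite: Berard1986, Ch. VII nº7 (iii); Chen2014, §3.5 Proposition 3.9] -/
theorem isBigO_tsum_alternating_oddPoly_mul_exp (q : ℕ → ℝ) (m : ℕ) (β : ℝ) :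
    (fun t : ℝ ↦ ∑' n : ℕ, (-1 : ℝ) ^ n * (∑ k ∈ Finset.range m, q k * (2 * (n : ℝ) + 1) ^ (2 * k + 1)) *
        rexp (-(t * ((n : ℝ) + 1 / 2) ^ 2))) =O[𝓝[>] 0] fun t : ℝ ↦ t ^ β := by
  have h := IsBigO.sum (s := Finset.range m) fun k _ ↦
    (isBigO_tsum_alternatingOddPow_mul_exp k β).const_mul_left (q k)
  refine h.congr' ?_ EventuallyEq.rfl
  filter_upwards [self_mem_nhdsWithin] with t (ht : 0 < t)
  have hsum : ∀ k ∈ Finset.range m, Summable fun n : ℕ ↦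
      q k * ((-1 : ℝ) ^ n * (2 * (n : ℝ) + 1) ^ (2 * k + 1) * rexp (-(t * ((n : ℝ) + 1 / 2) ^ 2))) := fun k _ ↦
    (summable_alternatingOddPow_mul_exp (2 * k + 1) ht).mul_left (q k)
  have step : ∀ n : ℕ, (-1 : ℝ) ^ n * (∑ k ∈ Finset.range m, q k * (2 * (n : ℝ) + 1) ^ (2 * k + 1)) *
      rexp (-(t * ((n : ℝ) + 1 / 2) ^ 2)) =
      ∑ k ∈ Finset.range m, q k * ((-1 : ℝ) ^ n * (2 * (n : ℝ) + 1) ^ (2 * k + 1) * rexp (-(t * ((n : ℝ) + 1 / 2) ^ 2))) := by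
    intro n
    rw [Finset.mul_sum, Finset.sum_mul]
    exact Finset.sum_congr rfl fun k _ ↦ by ring
  rw [tsum_congr step, Summable.tsum_finsetSum hsum]
  exact Finset.sum_congr rfl fun k _ ↦ tsum_mul_left.symm

end Literature.Analysis.InnerProduct
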